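import Literature.Analysis.Calculus.JacobianNullLagrangian
import Mathlib.Analysis.Calculus.LineDeriv.Basic

/-!
# `StokesGeneration` (stmt-KontsevichZagierPeriods-3586) — line `fibrewise_stokes`, stub `stub_jacobianMatrix_suspension`

Registered stub K3 (rung 15, wave 1) of the line `fibrewise_stokes` of the crux `StokesGeneration`
(route UnfoldedStokes): **the Jacobian matrix of the suspension**
`F(x, t) = ((1 - t) x + t Φ(x), t)` of the straight-line homotopy from the identity to a self-map `Φ`
of `ℝ^N` (coordinates `x = z ∘ Fin.castSucc`, `t = z (Fin.last N)` on `ℝ^{N+1}`), in the tree's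
convention `(jacobianMatrix f x) k j = ∂ⱼ fₖ (x)` of
`Literature/Analysis/Calculus/JacobianNullLagrangian.lean`:

  `DF(x, t) = [[(1 - t) I + t DΦ(x), Φ(x) - x], [0, 1]]`,

together with the **face property** used to kill the `x_j`-face terms of rule (2): if `Φ` maps each
face `{x_j = c}` (`c ∈ {0, 1}`) of the closed cube `[0,1]^N` into itself, then `∂ₖ Φⱼ = 0` on that
face for every `k ≠ j`.

Proof sketch. (1) Each component of `F` is an explicit product/sum of coordinate projections and of
`Φ ∘ (z ↦ z ∘ castSucc)`; `hasFDerivAt_apply`, `hasFDerivAt_pi`, the chain and product rules give its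
Fréchet derivative as an explicit continuous linear map (`jacSusp_component`), which is evaluated at
the basis vectors `Pi.single j 1`; the rows of `DF` are the derivatives of the components
(`fderiv_apply`, `Fin.snoc_castSucc`, `Fin.snoc_last`).
(2) For `x` in the closed cube with `x_j = c ∈ {0, 1}` and `k ≠ j`, the segment `s ↦ x + s • e_k`,
`s ∈ [-x_k, 1 - x_k] ∋ 0`, stays in the face `{x_j = c}` of the cube, so `Φⱼ` is constantly `c` along
it; since `Φ` is differentiable at `x` (the cube lies in the open set `U`), `∂ₖ Φⱼ (x) = DΦ(x)[e_k]ⱼ`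
is the derivative at `0` of `s ↦ Φⱼ (x + s e_k)` (`HasFDerivAt.hasLineDerivAt`), hence also a
derivative within the nontrivial interval `[-x_k, 1 - x_k]`, where the function is constant:
uniqueness of one-sided derivatives (`uniqueDiffOn_Icc`, `UniqueDiffWithinAt.eq_deriv`) gives `0`.

References: M. Kontsevich, D. Zagier, *Periods* (2001), §1.2, rule (2) (change of variables);
L. C. Evans, *Partial Differential Equations*, 2nd ed. (2010), §8.1.4.b (null Lagrangians).
-/

noncomputable section

-- `Summit.KontsevichZagierPeriods.KontsevichZagierPeriods.…` is the tree's mandated layout (single-conjunct summit).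
set_option linter.dupNamespace false

namespace Summit.KontsevichZagierPeriods.KontsevichZagierPeriods.Cruxes.StokesGeneration.FibrewiseStokes

open Set
open Literature.Analysis.Calculus (jacobianMatrix jacobianMatrix_apply)

/-- The spatial component `z ↦ (1 - t) x_k + t Φ_k(x)` (`x = z ∘ castSucc`, `t = z last`) of the
suspension is differentiable wherever `Φ` is, with directional derivative along `v` equal to
`(1 - t) v_k - x_k v_last + (t · DΦ(x)[v ∘ castSucc]_k + Φ_k(x) · v_last)`. [folklore] -/
private theorem jacSusp_component {N : ℕ} (Φ : (Fin N → ℝ) → (Fin N → ℝ))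
    (z : Fin (N + 1) → ℝ) (hΦ : DifferentiableAt ℝ Φ (fun l => z (Fin.castSucc l))) (k : Fin N) :
    DifferentiableAt ℝ (fun y : Fin (N + 1) → ℝ => (1 - y (Fin.last N)) * y (Fin.castSucc k) +
        y (Fin.last N) * Φ (fun l => y (Fin.castSucc l)) k) z ∧
    ∀ v : Fin (N + 1) → ℝ,
      fderiv ℝ (fun y : Fin (N + 1) → ℝ => (1 - y (Fin.last N)) * y (Fin.castSucc k) +
        y (Fin.last N) * Φ (fun l => y (Fin.castSucc l)) k) z v =
      (1 - z (Fin.last N)) * v (Fin.castSucc k) - z (Fin.castSucc k) * v (Fin.last N) +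
        (z (Fin.last N) * fderiv ℝ Φ (fun l => z (Fin.castSucc l)) (fun l => v (Fin.castSucc l)) k +
          Φ (fun l => z (Fin.castSucc l)) k * v (Fin.last N)) := by
  have hlast := hasFDerivAt_apply (𝕜 := ℝ) (Fin.last N) z
  have hk := hasFDerivAt_apply (𝕜 := ℝ) (Fin.castSucc k) z
  -- the projection `z ↦ z ∘ castSucc` is a continuous linear map, so `Φ ∘ (· ∘ castSucc)` is
  -- differentiable at `z` by the chain rule
  have hP := hasFDerivAt_pi.2 fun l : Fin N => hasFDerivAt_apply (𝕜 := ℝ) (Fin.castSucc l) z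
  have hΦk := hasFDerivAt_pi'.1 (hΦ.hasFDerivAt.comp z hP) k
  have h := ((hlast.const_sub 1).fun_mul hk).fun_add (hlast.fun_mul hΦk)
  have h' : HasFDerivAt (fun y : Fin (N + 1) → ℝ => (1 - y (Fin.last N)) * y (Fin.castSucc k) +
      y (Fin.last N) * Φ (fun l => y (Fin.castSucc l)) k) _ z := h
  refine ⟨h'.differentiableAt, fun v => ?_⟩
  rw [h'.fderiv]
  simp only [add_apply, smul_apply, neg_apply, ContinuousLinearMap.proj_apply,
    ContinuousLinearMap.coe_comp, Function.comp_apply, ContinuousLinearMap.coe_pi', smul_eq_mul]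
  ring

/-- **Face property.** If `Φ`, differentiable on an open set containing the closed cube, maps each
face `{x_j = c}` (`c ∈ {0, 1}`) of the closed cube into itself, then the tangential partial derivatives
`∂ₖ Φⱼ` (`k ≠ j`) vanish on that face (one-sided difference quotients along the segment
`x + s • e_k ⊆ {x_j = c}`). [folklore] -/
private theorem jacSusp_face {N : ℕ} (Φ : (Fin N → ℝ) → (Fin N → ℝ)) (U : Set (Fin N → ℝ))
    (hU : IsOpen U) (hsub : Set.pi Set.univ (fun _ : Fin N => Set.Icc (0:ℝ) 1) ⊆ U)
    (hΦU : DifferentiableOn ℝ Φ U)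
    (hface : ∀ x ∈ Set.pi Set.univ (fun _ : Fin N => Set.Icc (0:ℝ) 1), ∀ j : Fin N,
      (x j = 0 → Φ x j = 0) ∧ (x j = 1 → Φ x j = 1))
    (x : Fin N → ℝ) (hx : x ∈ Set.pi Set.univ (fun _ : Fin N => Set.Icc (0:ℝ) 1)) (j : Fin N)
    (hxj : x j = 0 ∨ x j = 1) (k : Fin N) (hkj : k ≠ j) :
    fderiv ℝ Φ x (Pi.single k 1) j = 0 := by
  have hΦx : DifferentiableAt ℝ Φ x := hΦU.differentiableAt (hU.mem_nhds (hsub hx))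
  -- the partial derivative `∂ₖ Φⱼ (x)` is the derivative at `0` of `s ↦ Φⱼ (x + s • e_k)`
  have hline : HasDerivAt (fun s : ℝ => Φ (x + s • Pi.single k 1) j)
      (fderiv ℝ Φ x (Pi.single k 1) j) 0 :=
    (hasFDerivAt_pi'.1 hΦx.hasFDerivAt j).hasLineDerivAt (Pi.single k (1:ℝ))
  -- the segment `x + s • e_k`, `s ∈ [-x_k, 1 - x_k]`, stays in the face `{x_j = x j}` of the cube
  have hxk : x k ∈ Set.Icc (0:ℝ) 1 := hx k (Set.mem_univ _)
  have h0S : (0:ℝ) ∈ Set.Icc (-x k) (1 - x k) := ⟨by linarith [hxk.1], by linarith [hxk.2]⟩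
  have hSu : UniqueDiffWithinAt ℝ (Set.Icc (-x k) (1 - x k)) 0 :=
    uniqueDiffOn_Icc (by linarith) 0 h0S
  have hseg : ∀ s ∈ Set.Icc (-x k) (1 - x k),
      x + s • (Pi.single k 1 : Fin N → ℝ) ∈ Set.pi Set.univ (fun _ : Fin N => Set.Icc (0:ℝ) 1) ∧
        (x + s • (Pi.single k 1 : Fin N → ℝ)) j = x j := by
    intro s hs
    refine ⟨fun m _ => ?_, ?_⟩
    · simp only [Pi.add_apply, Pi.smul_apply, Pi.single_apply, smul_eq_mul, mul_ite, mul_one,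
        mul_zero]
      split_ifs with hm
      · rw [hm]; exact ⟨by linarith [hs.1], by linarith [hs.2]⟩
      · rw [add_zero]; exact hx m (Set.mem_univ _)
    · simp [hkj.symm]
  -- so `Φⱼ` is constant (`= x j ∈ {0, 1}`) along it
  have hconst : ∀ s ∈ Set.Icc (-x k) (1 - x k), Φ (x + s • Pi.single k 1) j = x j := by
    intro s hs
    obtain ⟨hmem, hj⟩ := hseg s hs
    rcases hxj with h0 | h1
    · rw [h0]; exact (hface _ hmem j).1 (hj.trans h0)
    · rw [h1]; exact (hface _ hmem j).2 (hj.trans h1)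
  have hzero : HasDerivWithinAt (fun s : ℝ => Φ (x + s • Pi.single k 1) j) 0
      (Set.Icc (-x k) (1 - x k)) 0 :=
    (hasDerivWithinAt_const _ _ (x j)).congr_of_mem hconst h0S
  exact UniqueDiffWithinAt.eq_deriv _ hSu hline.hasDerivWithinAt hzero

/-- **Registered stub `stub_jacobianMatrix_suspension` (rung 15, K3): the Jacobian of the
suspension** `F(x, t) = ((1 - t) x + t Φ(x), t)` (coordinates `x = z ∘ castSucc`, `t = z last`):
`DF = [[(1 - t) I + t DΦ, Φ - x], [0, 1]]` in the tree's `jacobianMatrix` convention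
(`(jacobianMatrix f x) k j = ∂ⱼ fₖ`), plus the face property: if `Φ` preserves each face `{x_j = c}`
(`c ∈ {0, 1}`) of the closed cube then the tangential derivatives `∂ₖ Φⱼ`, `k ≠ j`, vanish on it.
[cite: KontsevichZagier2001, §1.2 rule (2)] -/
theorem stub_jacobianMatrix_suspension {N : ℕ} (Φ : (Fin N → ℝ) → (Fin N → ℝ))
    (F : (Fin (N + 1) → ℝ) → (Fin (N + 1) → ℝ))
    (hF : F = fun z => Fin.snoc (fun k => (1 - z (Fin.last N)) * z (Fin.castSucc k) +
      z (Fin.last N) * Φ (fun l => z (Fin.castSucc l)) k) (z (Fin.last N))) :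
    (∀ z : Fin (N + 1) → ℝ, DifferentiableAt ℝ Φ (fun l => z (Fin.castSucc l)) →
      DifferentiableAt ℝ F z ∧
      (∀ k l : Fin N, jacobianMatrix F z (Fin.castSucc k) (Fin.castSucc l) =
        (1 - z (Fin.last N)) * (if k = l then 1 else 0) +
          z (Fin.last N) * jacobianMatrix Φ (fun l => z (Fin.castSucc l)) k l) ∧
      (∀ k : Fin N, jacobianMatrix F z (Fin.castSucc k) (Fin.last N) =
        Φ (fun l => z (Fin.castSucc l)) k - z (Fin.castSucc k)) ∧
      (∀ l : Fin N, jacobianMatrix F z (Fin.last N) (Fin.castSucc l) = 0) ∧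
      jacobianMatrix F z (Fin.last N) (Fin.last N) = 1) ∧
    (∀ (U : Set (Fin N → ℝ)), IsOpen U → Set.pi Set.univ (fun _ : Fin N => Set.Icc (0:ℝ) 1) ⊆ U →
      DifferentiableOn ℝ Φ U →
      (∀ x ∈ Set.pi Set.univ (fun _ : Fin N => Set.Icc (0:ℝ) 1), ∀ j : Fin N,
        (x j = 0 → Φ x j = 0) ∧ (x j = 1 → Φ x j = 1)) →
      ∀ x ∈ Set.pi Set.univ (fun _ : Fin N => Set.Icc (0:ℝ) 1), ∀ j : Fin N, (x j = 0 ∨ x j = 1) →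
        ∀ k : Fin N, k ≠ j → jacobianMatrix Φ x j k = 0) := by
  refine ⟨fun z hΦ => ?_, fun U hU hsub hΦU hface x hx j hxj k hkj => ?_⟩
  · -- the components of `F`
    have hcomp : ∀ k : Fin N, (fun y => F y (Fin.castSucc k)) = fun y : Fin (N + 1) → ℝ =>
        (1 - y (Fin.last N)) * y (Fin.castSucc k) +
          y (Fin.last N) * Φ (fun l => y (Fin.castSucc l)) k := by
      intro k
      funext y
      simp only [hF, Fin.snoc_castSucc]
    have hlastc : (fun y => F y (Fin.last N)) = fun y : Fin (N + 1) → ℝ => y (Fin.last N) := by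
      funext y
      simp only [hF, Fin.snoc_last]
    have hdiff : DifferentiableAt ℝ F z := by
      refine differentiableAt_pi.2 (Fin.lastCases ?_ (fun k => ?_))
      · rw [hlastc]
        exact differentiableAt_apply (𝕜 := ℝ) _ _
      · rw [hcomp k]
        exact (jacSusp_component Φ z hΦ k).1
    -- entries of the Jacobian: row `i` is the derivative of the component `F · i`
    have hentry : ∀ i j, jacobianMatrix F z i j = fderiv ℝ (fun y => F y i) z (Pi.single j 1) := by
      intro i j
      rw [jacobianMatrix_apply, fderiv_apply hdiff i]
      rfl
    have hlast_ne : ∀ l : Fin N, Fin.last N ≠ Fin.castSucc l :=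
      fun l => (Fin.castSucc_lt_last l).ne'
    have hne_last : ∀ l : Fin N, Fin.castSucc l ≠ Fin.last N :=
      fun l => (Fin.castSucc_lt_last l).ne
    refine ⟨hdiff, fun k l => ?_, fun k => ?_, fun l => ?_, ?_⟩
    · rw [hentry, hcomp k, (jacSusp_component Φ z hΦ k).2, jacobianMatrix_apply]
      have h1 : (Pi.single (Fin.castSucc l) 1 : Fin (N + 1) → ℝ) (Fin.last N) = 0 :=
        Pi.single_eq_of_ne (hlast_ne l) _
      have h2 : (fun m => (Pi.single (Fin.castSucc l) 1 : Fin (N + 1) → ℝ) (Fin.castSucc m)) =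
          Pi.single l 1 := by
        funext m
        simp [Pi.single_apply, Fin.castSucc_inj]
      have h3 : (Pi.single (Fin.castSucc l) 1 : Fin (N + 1) → ℝ) (Fin.castSucc k) =
          if k = l then 1 else 0 := by
        simp [Pi.single_apply, Fin.castSucc_inj]
      rw [h1, h2, h3]
      ring
    · rw [hentry, hcomp k, (jacSusp_component Φ z hΦ k).2]
      have h1 : (Pi.single (Fin.last N) 1 : Fin (N + 1) → ℝ) (Fin.last N) = 1 :=
        Pi.single_eq_same _ _
      have h2 : (fun m => (Pi.single (Fin.last N) 1 : Fin (N + 1) → ℝ) (Fin.castSucc m)) = 0 := by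
        funext m
        exact Pi.single_eq_of_ne (hne_last m) _
      have h3 : (Pi.single (Fin.last N) 1 : Fin (N + 1) → ℝ) (Fin.castSucc k) = 0 :=
        Pi.single_eq_of_ne (hne_last k) _
      rw [h1, h2, h3, map_zero, Pi.zero_apply]
      ring
    · rw [hentry, hlastc, (hasFDerivAt_apply (𝕜 := ℝ) (Fin.last N) z).fderiv,
        ContinuousLinearMap.proj_apply]
      exact Pi.single_eq_of_ne (hlast_ne l) _
    · rw [hentry, hlastc, (hasFDerivAt_apply (𝕜 := ℝ) (Fin.last N) z).fderiv,
        ContinuousLinearMap.proj_apply]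
      exact Pi.single_eq_same _ _
  · -- the face property
    rw [jacobianMatrix_apply]
    exact jacSusp_face Φ U hU hsub hΦU hface x hx j hxj k hkj

end Summit.KontsevichZagierPeriods.KontsevichZagierPeriods.Cruxes.StokesGeneration.FibrewiseStokes

end
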